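import Summits.HodgeConjecture.CorCM.HypDel.ExtAmbientReceptacleHDel
import Summits.HodgeConjecture.CorCM.HypDel.ExtAmbientReceptacleQArchC
import Summits.HodgeConjecture.HodgeConjecture.Theorems.F1ExtHodgeTypeStubS2Imm
import Summits.HodgeConjecture.HodgeConjecture.Theorems.F1ExtHodgeTypeStubS2Pair
import Summits.HodgeConjecture.HodgeConjecture.Theorems.F1ExtHodgeTypeStubFrame
import Summits.HodgeConjecture.HodgeConjecture.Theorems.F1ExtHodgeTypeStubS2inj
import Summits.HodgeConjecture.HodgeConjecture.Theorems.F1ExtHodgeTypeStubS4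
import Summits.HodgeConjecture.HodgeConjecture.Theorems.F1ExtHodgeTypeStubSQuot
import Summits.HodgeConjecture.HodgeConjecture.Theorems.F1ExtHodgeTypeStubS2ImmHolds
import Literature.AlgebraicGeometry.ShimuraVarieties.SiegelBorelExtensionHolds
import HarnessLib
import Summits.HodgeConjecture.CorCM.HypDel.MumfordModuliReceptacle
import Summits.HodgeConjecture.HodgeConjecture.Theorems.MumfordRouteXiAssembly
import Summits.HodgeConjecture.CorCM.HypDel.M1primeOfFU   -- v5.0: ★ E-FU HEAD `M1prime_of_F_U : (F) → (U) → M1′` (Road S chain Part1…Part7 + HEAD)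
import Literature.AlgebraicGeometry.ModuliOfAbelianVarieties.SiegelFineModuliSchemeRelDim   -- v5.2: ★ p737414 (F′) `lan2013_siegelFineModuliScheme_relDim` + plug `lan2013_of_relDim` (director s164 Y-E2)
import Summits.HodgeConjecture.HodgeConjecture.Theorems.UOfF   -- v5.2: ★ p737802 `UOfF.U_of_relDim_F` — (U) IS A THEOREM of (F′) (B-p12 g13; UHead v0.22 port)
import Summits.HodgeConjecture.HodgeConjecture.Theorems.EquidimRelDimOfF   -- v5.3: ★ p755621 E-road head `relDim_of_F : (F) → (F′)` sorry-free (EQUIDIM BY PROOF; B-plan1 E-road pen)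
import Literature.AlgebraicGeometry.ModuliOfAbelianVarieties.SiegelFineModuliSchemeLevelDescent   -- v5.4: ★ p766238 F-10 LEVEL DESCENT `lan2013_siegelFineModuliScheme_of_large_levels` — (F) ⟸ the (F) clauses at all LARGE levels (B-plan1 g16 F-DAG node F-10; B-p02 g13 (pack))
import Literature.AlgebraicGeometry.ModuliOfAbelianVarieties.SiegelFineModuliSchemeOfCores   -- v5.5-C: F-12-of-cores ED. 2 `exists_threshold_siegelFineModuliScheme_of_cores'` (B-p11 (g19) v3 variant (iii) 553295abf326cc2c; ★ p793324, 2026-08-30)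
import Summits.HodgeConjecture.HodgeConjecture.Theorems.F13PluckerProducerStubPL   -- v5.6 «Q-PL»: ★ p795314 the importable twin of the sorry-free F-13 line (`stub_PL_of_cores_holds : ‹II› → ‹F3› → ‹PL›`, TRIO)
import Literature.AlgebraicGeometry.AbelianSchemes.LinearRigidificationStepTwo   -- v5.8 «Q-II»: ★ p796432 F23 `AbelianSchemeOver.exists_groupLawLocus_of_projective` — CORE II (hII″) IS A THEOREM ([MFK94] Prop. 6.16 + Thm. 6.14 Step II, projective; F-4 line `Cruxes/HDel/Lines/F4LinearRigidificationII` ED. 3f `stub_IIrep'` TRIO)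
import Summits.HodgeConjecture.HodgeConjecture.Theorems.F3DualAbelianSchemeStubF3   -- v5.9 «Q-F3»: ★ p797885 T4 `…F3DualAbelianScheme.stub_F3_holds` — CORE F3 IS A THEOREM (F-3 line `Cruxes/HDel/Lines/F3DualAbelianScheme` letters (K) p792729 · (L) p788891 · (Z) p797538 · (M) p797770; F0P1c-p06 (g2))
import Summits.HodgeConjecture.HodgeConjecture.Theorems.F11SmoothRoadAStubF11   -- v5.10 «Q-F11»: ★ p806948 `…F11SmoothRoadA.stub_F11_holds` — CORE F11 IS A THEOREM (F-11 line `Cruxes/HDel/Lines/F11SmoothRoadA` ED. 5 over α1-P `…stub_liftWithLineBundle_holds` (grandchild `F11LiftWithLineBundle` v0.3b: G0 p792666 · G1-P MONO-G1 · G2-P MONO-G2) and α2′ (T4 rider p797885); F0P1b cell, author B-p05)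

/-!
# Crux workfile `Cruxes/HDel/Lines/F1ExtHodgeType.lean` — v4.6 «Q-ARCHITECTURE» (FINAL EDITION: every provable stub closed by name; sorries = the two NAMED FACTS) (BY IMPORT of the τ0 modules QArchA/QArchB/QArchC) (B-plan2 g5, T3 pen; registry of stmt-HodgeConjecture-24835)

EDITION v5.10 «Q-F11 — CORE F11 IS A THEOREM; THE REGISTRY SKELETON IS SORRY-FREE» (registrar B-plan1 (g20) pre-cut, B-plan1 (g21) bytes 2026-08-31 03:28Z; director g14 go-on-green «Q-F11», same boxes as Q-II∕Q-F3): = v5.9 1bf4da17 with the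
LAST registered `sorry`, `stub_F11` (the frozen B-p13-form letter «smoothness over ℚ of an abstract Siegel fine moduli scheme locally of finite type»), REPLACED by the bare name
`Summit.HodgeConjecture.CorCM.Cruxes.HypDel.F11SmoothRoadA.stub_F11_holds` of ★ `Summits/HodgeConjecture/HodgeConjecture/Theorems/F11SmoothRoadAStubF11.lean` (B-p05 (g20), the importable twin of the
F-11 sub-line `Cruxes/HDel/Lines/F11SmoothRoadA.lean` head `stub_F11`, plan F0P1b-plan (g0→g2), cutter F0P1a-p01 (g2); letters α1-P `stub_liftWithLineBundle` (grandchild line `F11LiftWithLineBundle` v0.3b: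
G0 ★ p792666 · G1-P ★ p805275 MONO-G1 `Theorems/F11StubG1AbelianLift` · G2-P ★ p805743 MONO-G2 `Theorems/F11StubG2LineBundleLift`) · α2′ `stub_dualPairOfLift` ★ p797885 rider · junction-P ★ p795680; statement token-identical to `stub_F11`;
the twin imports Theorems∕Literature only — no `Cruxes/…/Lines`, registry acyclic) and ONE `import` line; every other token of v5.9 byte-identical.  Registered `sorry`s 1 → 0;
`HDel_proof` — the theorem concluding the crux decl `Summit.HodgeConjecture.HodgeConjecture.Theses.HCCMUnconditional.HDel` BY NAME — has `#print axioms` = [propext, Classical.choice, Quot.sound].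
HC_CM is proved only modulo the 7 printed citations until rung 0 closes (this file discharges hDel of the generic floor on Mathlib + the ★ Literature facts it imports; it says nothing about HC).

EDITION v5.9 «Q-F3 — CORE F3 IS A THEOREM» (registrar B-plan1 (g20) bytes 2026-08-31 00:3xZ; director g14 s405 (b)∕s406 go-on-green, same boxes as Q-II): = v5.8 959becb4 with the
registered `sorry` of `stub_F3` (the (L)-letter «dual pairs Zariski-locally of projective abelian schemes», frozen since v4.x) REPLACED by the bare name
`Summit.HodgeConjecture.CorCM.Cruxes.HypDel.F3DualAbelianScheme.stub_F3_holds` of ★ p797885 `Summits/HodgeConjecture/HodgeConjecture/Theorems/F3DualAbelianSchemeStubF3.lean`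
(F0P1c-p06 (g2), T4 = the importable twin of the F-3 sub-line `Cruxes/HDel/Lines/F3DualAbelianScheme.lean` head `stub_F3`, lead B-p02 (g17), plan F0P1c-plan (g0); hand letters
(K) ★ p792729 · (L) ★ p788891 · (Z) ★ p797538 (T0) · (M) ★ p797770 (T3, over (Ma)(Mb) p796744 · (Mc) p797599 · (N3′) p797055 · S-f p796435); statement token-identical to `stub_F3`;
T4 imports Theorems∕Literature only — no `Cruxes/…/Lines`, registry acyclic) and ONE `import` line; every other token of v5.8 byte-identical.  Registered `sorry`s
2 → 1 = {`stub_F11`}; `HDel_proof`'s cone = that one + theorems.  HC_CM is proved only modulo the 7 printed citations until rung 0 closes.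

EDITION v5.8 «Q-II — CORE II IS A THEOREM» (registrar B-plan1 (g20) bytes 2026-08-30 23:5xZ; ONLY on director g14's word, same boxes as Q6∕Q7): = v5.7 with the
registered `sorry` of `stub_II` (the print-exact hII″ letter served since v5.7) REPLACED by the bare name
`Literature.AlgebraicGeometry.AbelianSchemes.AbelianSchemeOver.exists_groupLawLocus_of_projective` of ★ p796432
`Literature/AlgebraicGeometry/AbelianSchemes/LinearRigidificationStepTwo.lean` (F0P1a-p02 (g2), F23 = the importable twin of the F-4 sub-line
`Cruxes/HDel/Lines/F4LinearRigidificationII.lean` ED. 3f `stub_IIrep'`, lead B-p17 (g15); layer-2 letters (II-a-E) p795442 · (II-b) p796070 · (II-c₁) p795135 · (II-c₂) ·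
(II-d) · (II-e) p794138 all ★; statement ws-identical to `stub_II`, 718 chars) and ONE `import` line; every other token of v5.7 byte-identical.  Registered `sorry`s
3 → 2 = {`stub_F3`, `stub_F11`}; `HDel_proof`'s cone = those two + theorems.  HC_CM is proved only modulo the 7 printed citations until rung 0 closes.

EDITION v5.7 «Q7 — CORE II PRINT-EXACT, MERGED WITH Q-PL» (bytes F0P1a-p01 (g2) ad746b4a1a78801c, director g14 s389∕s394 (M), written 2026-08-30 23:51Z commit
d790cf32a9ff, ONE `skeleton check` 23:51:51Z: stubs registered {`stub_II`, `stub_F3`, `stub_F11`}): = v5.5-C4 with EXACTLY three hunks — `stub_II` TYPE := hII″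
(`∀ g`, `IsProjective p₁`, no `IsClosed (Set.range j₂)` conjunct; [MFK94] Prop. 6.16 + Thm. 6.14 (representability half), ≤ print verbatim), `stub_PL :=
…F13PluckerProducer.stub_PL_of_cores_holds' stub_II stub_F3` (★ p796000, `Theorems/F13PluckerProducerStubPL` ED. 2), `stub_Flarge :=
…exists_threshold_siegelFineModuliScheme_of_cores'' stub_II stub_F3 stub_PL stub_F11` (★ p796022, F-12-of-cores ED. 3) — plus the v5.6 import below.

EDITION v5.6 «Q-PL — CORE PL IS A THEOREM OF THE CORES II AND F3» (registrar B-plan1 (g20) bytes 2026-08-30 23:3xZ, director g14 s385 GO-ON-GREEN on the F-13 twin ★;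
Q6 protocol s368 boxes (a)–(d)): = v5.5-C4 d3 73dcce37fd210eb1 with the registered `sorry` of `stub_PL` REPLACED by the application
`Summit.HodgeConjecture.CorCM.Cruxes.HypDel.F13PluckerProducer.stub_PL_of_cores_holds stub_II stub_F3` of ★ p795314
`Summits/HodgeConjecture/HodgeConjecture/Theorems/F13PluckerProducerStubPL.lean` (B-p10 (g15) filer, bytes F0-typ2 (g0); the importable twin of the sorry-free F-13
sub-line `Cruxes/HDel/Lines/F13PluckerProducer.lean` v1.4 ede89b42 — producer B-p10 (g13), stubs closed by B-p11 (g19∕g20): P3 `SiegelLinearRigidificationFrameClasses`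
p790778 · P2b `HilbertImagePluckerClass` p791887 · P4 `SiegelFramedCovariantPlucker` p793571 over P0 p792748 · R-C2 p791836 · (M2b) ED. 2 p792358 · R-C1) and ONE new
`import` line; EVERY other token of v5.5-C4 (all statements, all docstrings below this paragraph, all other bodies) is byte-identical.  Registered `sorry`s 4 → 3 =
{`stub_II`, `stub_F3`, `stub_F11`}; `HDel_proof`'s cone = those three + theorems ([MFK94 Prop. 7.4 ∕ §7.2] is now kernel-visible modulo Thm. 6.14 and Cor. 6.8).
HC_CM is proved only modulo the 7 printed citations until rung 0 closes.

EDITION v5.5-C4 «CORES OVER ED. 2 — variant (iii): hHilb AND hF9 BY NAME» (B-plan2 (g16) bytes 2026-08-30 22:4xZ = the g14∕g15 draft C4 d2 fe36b50853d67969 with THIS paragraph finalised, decls byte-identical; director g12 s238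
«cores edition» + s276 (i) «`stub_PL` replaces `stub_Hrep`»; post-wave chain ★: R-C2 (Q1) p791836 · (M2b) ED. 2 (Q2) p792358 · (M2) ED. 4 (Q3) p792942 · F-12-of-cores
ED. 2 variant (iii) 553295abf326cc2c (Q4) p793324 (author B-p11 (g19), filer B-p06 (g14)); «WAVE CLEAR» 21:50:39Z; written by the 24835 registrar on director g13's word):
= v5.4 c8ce6209e424d71a with the ONE registered `sorry` `stub_Flarge` ([MFK94, Thm. 7.9] «for `n` large», opaque) REPLACED by an APPLICATION of the tree theorem
`Literature.AlgebraicGeometry.ModuliOfAbelianVarieties.exists_threshold_siegelFineModuliScheme_of_cores'` (F-12-of-cores ED. 2, B-p11 g18: `hHrep` DISSOLVED by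
R2⁺ `hatNormalised` + ★ R-C1 + ★ R-C2 into its print-located residue `hPL`; `hF9a` ★ BY NAME; `hHilb` ★ BY NAME from F-5 ⑦b ED. 4 `exists_grassmannianImmersion_universal_flat_family`, U50; `hF9` ★ BY NAME from B-p10's (M2d) closer `SiegelFineModuliScheme.isQuasiProjectiveOver_of_charts_of_PL`, F-12 variant (iii), ★ p793324) to FOUR registered core stubs, each the corresponding binder
letter of that head VERBATIM and each ≤ ONE printed statement with a page locator: `stub_II` [MFK Thm. 6.14 + Prop. 7.3 (II)] (abelian-scheme locus, group law as data; HONEST OVER-STRENGTH LABEL s279 (1b): proper where print has projective — repair (β) booked for F-12 ed. 3), `stub_F3`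
[MFK Cor. 6.8 ∕ Lan 1.3.2.3] (dual abelian schemes), `stub_PL` [MFK Prop. 7.4 + §7.2 (*) ∕ Def. 7.5 ∕ Prop. 6.13 (ii)(iv)] (the Plücker letter of the linearly
rigidified covariant, REF1 m09∕m11 + ref2 l23∕l24 ≤-print reads), `stub_F11` [Lan Thm. 1.4.1.11 ∕ 2.2.4.14] (smoothness over `ℚ`).  NO stub concludes a `SiegelFramedCovariant` ∕ `SiegelFineModuliScheme` existence
(s254 (2)); `stub_Hrep` of the dead C1 draft is OUT (dissolved, not re-filed).  Registered `sorry`s 1 → 4 (finer, not more: the one opaque [MFK Thm. 7.9] is now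
four named printed statements; s67 «kind beats count»; s238 (5): hDel's sub-ledger «rests on 4 printed statements», each later core ★ a kernel-visible one-line
edition v5.6-C, …); EVERY statement token of v5.4 outside `stub_Flarge`'s docstring headline and proof body is byte-identical; `HDel_proof`'s cone = the four
stubs + v5.4's theorems.  HC_CM is proved only modulo the 7 printed citations until rung 0 closes.
EDITION v5.4 «F-10 RIDER — LEVEL DESCENT BY PROOF; the registered sorry MOVED to (F) AT LARGE LEVEL» (B-plan2 g13, 2026-08-30; ONLY on the seated director's word after
the F-10 node ★ p766238 `lan2013_siegelFineModuliScheme_of_large_levels : (∀ large N, (F)-clauses) → (F)` landed sorry-free BY NAME): = v5.3 with the ONE registered `sorry`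
now `stub_Flarge : ∃ β, ∀ g N δ, 0 < g → IsPolarizationType δ → 3 ≤ N → β g δ ≤ N → ∃ 𝓜, Smooth ∧ quasi-projective ∧ quasi-projective total space` ([MFK94, Thm. 7.9]
«for `n` large» verbatim) and `stub_F` turned into the THEOREM `lan2013_siegelFineModuliScheme_of_large_levels β h` (★ F-10: quotient `A_{g,δ,N} = A_{g,δ,Nd}/Γ` with the
clauses of (F), [MFK94] remark after Thm. 7.9 + Lemma 7.11, [Lan13] Cor. 1.4.1.12).  Registered `sorry`s 1 → 1: {stub_F} → {stub_Flarge}; EVERY statement token of v5.3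
byte-identical (one stub + one import added; `stub_F`'s body :228–231 is now a proof).  F-12 = F-8 ∕ F-9 ∕ F-11 at large level + ★ F-10: what is left under hDel is
Mumford's theorem AT LARGE LEVEL only.
HC_CM is proved only modulo the 7 printed citations until rung 0 closes.

EDITION v5.3 «E-ROAD LANDED — EQUIDIM BY PROOF; binder hDel RE-KEYED to (F) AS PRINTED» (B-plan2 g12, 2026-08-29/30; ONLY on the seated director's word after the
E-road head ★ p755621 `relDim_of_F : (F) → (F′)` landed sorry-free BY NAME): = v5.2 with `stub_F : lan2013_siegelFineModuliScheme := by sorry` the ONE registered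
`sorry` again ([Lan2013, Thm. 1.4.1.11] + [MFK94, Thm. 7.9] verbatim, NO relative-dimension numeral in the citation) and `stub_F'` turned into the THEOREM
`relDim_of_F stub_F` (the numeral `g(g+1)/2` DERIVED in the tree: G-AN1 P4-piece ★ lane T + THICK ⇔ NOT THIN ★ + Hecke link ★).  Registered `sorry`s 1 → 1:
{stub_F'} → {stub_F}; EVERY statement token of v5.2 byte-identical (decl order: `stub_F` now precedes `stub_F'`; bodies :192/:197–199 swap roles; one import added).
HC_CM is proved only modulo the 7 printed citations until rung 0 closes.

EDITION v5.2 «E-EQUIDIM / Y-E2 — (U) IS A THEOREM» (B-plan2 g11/g12, 2026-08-29, director s164 (Q1)(Q2); ONLY on the seated director's filing word): = v5.1 with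
`stub_U : siegelModuli_complexUniformisation` turned into a THEOREM `UOfF.U_of_relDim_F stub_F'` (★ p737802: the UHead (U)-road — ★ (C) U-a `Ua_holds_of_residual` at
★ M13 `U_a3_residual_of_M13`, ★ glue `glue_core`, U-e = P4 ★ `UeP4OfF.ue_P4_of_F` ((N3-core) = (R) + (I)) + P5 + P6, EQUIDIM from the relative dimension) and
`stub_F` into the THEOREM `lan2013_of_relDim stub_F'`, over the ONE new registered FACT stub `stub_F' : lan2013_siegelFineModuliScheme_relDim` ((F′) = ★ p737414:
(F) WITH the printed relative dimension `g(g+1)/2`, [GortzWedhorn2023, Thm. 27.301 p. 733] + [Lan2013, Thm. 1.4.1.11]).  Registered `sorry`s 2 → 1: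
{stub_F, stub_U} → {stub_F'}; EVERY statement token of v5.1 byte-identical (only the two proof bodies :181/:186 change; one stub + two imports added).
HC_CM is proved only modulo the 7 printed citations until rung 0 closes.

EDITION v5.1 (B-plan2 g8, 2026-08-29; ref2 ≤-print stray (a) 04:39:29Z, routed B-typ04 04:39:58Z): = v5.0 with ONE docstring locator token of `stub_F` corrected — «Thm. 1.4.1.11 (p. 76)» → «(p. 91)», the book pagination of the ★ (F) fact file `SiegelFineModuliSchemeExists.lean` :127 (lit-verified); every declaration, statement and proof byte of v5.0 unchanged (stubs {stub_F, stub_U}, head `HDel_proof`, axioms trio).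
EDITION v5.0 «E-FU — M1′ IS A THEOREM OF (F) AND (U)» (B-plan2 g8, 2026-08-29, director s91 (3) / s95 / s96, B-plan1 R22–R24; ONLY on the director's
«E-FU EXECUTE — registry v5.0 GO» word): = v4.9 with the ONE registered fact stub `stub_mumford : deligne1971_siegelModuliOnPoints` ([Del71] 4.16–4.21 on
points, #60′) turned into a THEOREM of two finer registered fact stubs — `stub_F : lan2013_siegelFineModuliScheme` ((F) = ★ `SiegelFineModuliSchemeExists`
p691445, [Lan 2013, Thm. 1.4.1.11 + Cor. 7.2.3.9]) and `stub_U : siegelModuli_complexUniformisation` ((U) = ★ `SiegelModuliComplexUniformisation` p691693,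
[MFK94 App. 7A; Del71 4.12–4.21; Milne 2005 Thm. 6.11]) — through the kernel-checked E-FU head ★ `Summit.HodgeConjecture.CorCM.HypDel.M1primeOfFU.M1prime_of_F_U`
(★ p695378 `Summits/HodgeConjecture/CorCM/HypDel/M1primeOfFU.lean`, Road S chain Parts 1–7 ★ p690965 · p691858 · p691408 · p691992 · p692286 · p693936 · p694899).  Registered `sorry`s 1 → 2: {stub_mumford} → {stub_F, stub_U};
EVERY other token of v4.9 unchanged (`stub_S1`, the receptacle stubs, `HDel_proof`, `HDel_of_S1`, `HDel_of_two_facts'`); `#print axioms HDel_proof` = trio +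
`sorryAx` from exactly {stub_F, stub_U}.  Books are the director's (s96/s97: #60′ CLOSED-BY-DERIVATION over rows I-10 (F) / I-11 (U)).  By-name consumer:
`Theorems/HCCMUnconditionalHDelOfFU.lean :: hc_cm_of_generic_floor_v4 (hF) (hU) …` (B-p19).  HC_CM is proved only modulo the 7 printed citations until rung 0 closes.

EDITION v4.9 «MUMFORD LINE — END STATE» (B-plan2 g6, 2026-08-28, director s88 (2)(b) / s90 (B3); `B-plan/T3-NEXT-MUMFORD-REGISTRATION.md` §R1–§R13,
`B-plan/lines/mumford/MUMFORD-SKELETON-SPEC.md` §12): = v4.7 with the LAST FACT STUB `stub_S1 : SiegelS1` (#60, [Del71] Thm 4.21) turned into a THEOREM of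
this file — `stub_S1 := Summit.HodgeConjecture.CorCM.HypDel.MumfordModuli.siegelS1_of_cmConjugationIsogenyAll stub_mumford
Summit.HodgeConjecture.HodgeConjecture.Theorems.MumfordRouteXi.cmConjugationIsogenyAll_holds` (§1′ below) — over TWO new imports and ONE new registered FACT stub:
(i) the Summits-side RECEPTACLE ★ `Summits/HodgeConjecture/CorCM/HypDel/MumfordModuliReceptacle.lean` (B-plan1 g6, R4; ns `…CorCM.HypDel.MumfordModuli`:
closed Props `CMAdaptedMarkings(All)` / `CMConjugationIsogeny(All)` / `CompletedSandwich` / `MarkingTransport`, heads `isCanonical_of_isModuli`,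
`siegelS1_of_cmConjugationIsogenyAll (hM) (hC) : SiegelS1`); (ii) B-p09's hypothesis-free ROUTE-ξ′ ASSEMBLY ★
`Summits/HodgeConjecture/HodgeConjecture/Theorems/MumfordRouteXiAssembly.lean` (`MumfordRouteXi.cmConjugationIsogenyAll_holds`, axioms = {propext,
Classical.choice, Quot.sound}; over ★ T1′ `ModuliOfAbelianVarieties/SiegelModuliInterpretation` p663562 (`SiegelRationalModel.IsModuli`, `SiegelAdelicMarking`),
★ `SiegelAdelicMarkingExists` p664186, B-p01's ★ `SiegelAdelicMarkingHoms`, and the ROAD-60 on-points leaves ★ R60-55/56/57a/57b/58/61 + J1-i); (iii) the stub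
`stub_mumford : Literature.AlgebraicGeometry.ModuliOfAbelianVarieties.deligne1971_siegelModuliOnPoints` (★ `ModuliOfAbelianVarieties/SiegelModuliModel.lean`,
B-typ04 g8; fact M1′ = books row #62: for `0 < g`, `IsPolarizationType δ`, some Siegel ℚ-model `R` has `R.IsModuli ∧ R.HasIntegralHecke` — the level-`K_δ(N)`,
`N ≥ 3`, Siegel modular variety is a MODULI scheme on points; [Del71] 4.16–4.17 p. 150 + proof of Thm 4.21 p. 152, [MFK94] Thm 7.9/7.10 + Remark p. 139).
THE SWAP: `IsCanonical` (reciprocity at the CM pairs, [MilISV] (62)) is DERIVED from `IsModuli` — the Galois action on a CM moduli point is read off the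
moduli interpretation through CM-adapted adelic markings and the conjugation isogeny with its adelic congruence (route ξ′; receptacle `isCanonical_of_isModuli`),
all proved sorry-free in the tree — so the one printed input left under binder hDel is MUMFORD's existence of the moduli ℚ-scheme, not Deligne's canonicity
theorem.  Registered `sorry`s 1 → 1: {stub_S1} → {stub_mumford}; EVERY statement token of v4.7 (head `HDel_proof`, `HDel_of_S1`, `HDel_of_two_facts'`, the
eleven stub signatures) is byte-identical — this edition differs from the REF1-pre-certified code bytes 746bb06599e6b08f (m05, 2026-08-28T21:21:04Z: stmt_extract
diff = ∅ against v4.7, LEAF sorried stubs = [stub_mumford], `HDel_of_S1` axioms = trio) by THIS docstring paragraph only.  Books are the director's (s90 (C):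
#60 `SiegelS1` WITHDRAWN-AS-ROW = a theorem over #62; #62 GENERIC unproved; fan A 3/7 unchanged until `stub_mumford` is a theorem).  By-name twins:
`Theorems/HCCMUnconditionalHDelOfMumford.lean` (A-p05: `siegelS1_of_mumford` / `HDel_of_mumford (hM)` through ★ `Theorems.HDel_of_S1` p654476) and FLOOR-G v3
`hc_cm_of_generic_floor_v3 (hM : deligne1971_siegelModuliOnPoints) …` (B-plan1 / A-p07).  p-ids of (i)–(iii) and of `SiegelAdelicMarkingHoms`: line card §v4.9.

EDITION v4.7 (B-plan2 g5, 2026-08-28, director s87 (1) «v4.7: GO on ★ L4»): = v4.6 with the BOREL FACT STUB CLOSED BY NAME — `stub_borel :=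
Literature.AlgebraicGeometry.ShimuraVarieties.siegel_borel_extension_holds` (★ p653988, A-p14 g6, L4 assembly of the cell's #61 table led by B-p20 g4
under director s86 (2)(a) + ADDENDUM: L3 ★ p652662 `UnitaryBallUniformisationDatum.exists_hom_of_holomorphicSiegelLift` (B-p20) over ★ Arapura
`Transcendental.arapura2012_cor_15_4_6_holds` as a black box, N3 ★ p651661 `Motives.ClosedGraphMorphismImmersion` (B-p20), L1/G1 ★ p652289
`Geometry.Manifold.MDifferentiableOfLocalDiffeomorphComp` (B-p03 g8), P1 `SiegelUniformisationHolomorphicInto` (B-p13 g11, banked); dedup B-p18 g9;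
reading A-p14 17:14:00Z / B-p20 17:11:04Z).  Registered `sorry`s 2 → 1 = {`stub_S1` : `SiegelS1`, FACT #60 [Del71] Thm 4.21}; NEW in-file
`theorem HDel_of_S1 (hS1 : SiegelS1) : …HCCMUnconditional.HDel` with `#print axioms` free of `sorryAx` (§9).  Inventory effect is the director's to
book (row #61 GENERIC: named fact → theorem over Mathlib + the ★ transcendence facts in the import cone of `siegel_borel_extension_holds`).

EDITION v4.6 — FINAL (B-plan2 g5, 2026-08-28, director s83 (4)): = v4.5 with the LAST provable stub re-pointed by name,
`stub_periodChart := Theorems.stub_periodChart_holds` (★ p650963 `F1ExtHodgeTypeStubS2ImmHolds`, B-p05 g6 TARGET 1 over ★ L3b `UnitaryAuxiliaryPeriodMap`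
p650602 (export `periodChart`: the left-eigenrow period chart of `J_x`, holomorphic and immersive on the ball), L3a ★ p648612, L2 ★ p647761, L1 p646941;
seconds B-p07 / B-p12 / B-p15), and the GENERIC-FLOOR FORM of the head written out in-file: `theorem HDel_of_two_facts' (hS1 : SiegelS1)
(hB : siegel_borel_extension) : …HCCMUnconditional.HDel` — NO `sorry` anywhere in its cone (the five provable inputs frame · S2inj · S2pair-analytic ·
S2imm · Squot · S4 are ★ theorems; the two binders are the NAMED FACTS of fan-B rows #60 `SiegelS1` = [Del71] Thm 4.21 and #61 `siegel_borel_extension`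
= Borel 1972 Thm 3.10).  Registered sorries after v4.6 = 2 = {stub_S1, stub_borel} = exactly the two facts; `HDel_proof` (hypothesis-free, through the
two FACT stubs) stays the registered head, so item 24835 remains OPEN until the two facts are theorems (director 16:08:06Z erratum: fan A moves only on a
hypothesis-free `HDel`).  The by-name twin `Theorems/HCCMUnconditionalHDelOfTwoFacts.lean :: HDel_of_two_facts` (A-p08 g6, s83 (2)) feeds B-plan1's
GENERIC FLOOR 7 `hc_cm_of_generic_floor_v1` (filer A-p07).

EDITION v4.5 (B-plan2 g5, 2026-08-28, director s83 (4)): = v4.4 with FOUR provable stubs RE-POINTED BY NAME onto their ★ hypothesis-free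
closers (registered short name + signature verbatim, ns `Summit.HodgeConjecture.HodgeConjecture.Theorems`): `stub_frame := Theorems.stub_frame`
(★ p649453 `F1ExtHodgeTypeStubFrame`, B-p03 g7 — leaves P1 ★ p646547, P2a ★ p646939, ★ p647286, P2 SplitLattice ★ p647855, ★ p648597, NB ★ p647549
B-p11, (C) ★ p648546 B-typ03), `stub_S2inj := Theorems.stub_S2inj` (★ p649252 `F1ExtHodgeTypeStubS2inj`, A-p05 g6 — ★ p647246, ImageStationarity
★ p647806, CORE ★ p648557, F-iii ★ p648002 B-p09), `stub_S4 := Theorems.stub_S4` (★ p650008 `F1ExtHodgeTypeStubS4`, A-p04 g7 — ★ p645471/p647745/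
p647544/p647011 + B-p16 (B) ★ p647353 / §5 p645614 / §6 p647956), `stub_Squot := QArch.stub_Squot` (★ p650383 `F1ExtHodgeTypeStubSQuot`, B-p01 g6 lead,
ns `…ExtReceptacle.QArch` — D5 ★ p646411, D3 ★ p648173, (θ) ★ p647875 B-p18, Y-PACK ★ p649556 B-p18, D1-PACK ★ p649125 B-p02, D4-APP ★ p649602 B-p14,
D2b ★ p644280 / D4-bkk ★ p643488 B-p06 g4, Q4 ★ p640359/p643475 B-p02).  Registered sorries after v4.5 = 3 = {stub_S1 (FACT #60), stub_periodChart
(B-p05, L3b green — the LAST provable stub), stub_borel (FACT #61)}; v4.6 = the last edition (sorries 2 = the FACT stubs) with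
`HDel_of_two_facts (hS1) (hB)` (A-p08, `Theorems/HCCMUnconditionalHDelOfTwoFacts.lean`, s83 (2)).

EDITION v4.4 (B-plan2 g5, 2026-08-28): = v4.3 with `stub_S2pair` RE-POINTED BY NAME onto the ★ closer
`Summits/HodgeConjecture/HodgeConjecture/Theorems/F1ExtHodgeTypeStubS2Pair.lean :: stub_S2pair_holds (hB) (hP)` (A-p08 g6, ★ p647285 commit 27cbce495218; leaves α ★ p645594
B-p09 `UnitaryAuxiliarySiegelPointWellDefined`, β ★ p646597 A-p08 `UnitaryAuxiliarySiegelSliceLift`): `stub_S2pair := stub_S2pair_holds stub_borel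
stub_periodChart` is now a THEOREM of this file; the NEW registered stub `stub_borel : siegel_borel_extension` is the (σ5) NAMED FACT (★ p642679,
Borel 1972 Thm 3.10 / [MilISV] 3.14 — fan-B inventory row #61, GENERIC; director s67 «kind beats count», s74/s77 (7)), and `stub_periodChart` (v4.3)
now serves BOTH analytic closers.  Registered stubs after v4.4: {stub_S1 (FACT #60), stub_frame, stub_S2inj, stub_borel (FACT #61),
stub_periodChart, stub_Squot, stub_S4} = 7 names, 2 facts + 5 provable; `stub_S2imm`, `stub_S2pair` closed by name.

EDITION v4.3 (B-plan2 g5, 2026-08-28): = v4.2 with `stub_S2imm` RE-POINTED BY NAME onto the ★ closer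
`Summits/HodgeConjecture/HodgeConjecture/Theorems/F1ExtHodgeTypeStubS2Imm.lean :: S2Imm_of_periodChart` (B-p05 g6, p645479):
`stub_S2imm := S2Imm_of_periodChart stub_periodChart` is now a THEOREM of this file, and the NEW registered stub `stub_periodChart` carries the
closer's one hypothesis VERBATIM — the holomorphic immersive PERIOD CHART of `J_{β,Φ}` after every real similitude of negative multiplier
(B-p05 TARGET 1 `UnitaryAuxiliaryPeriodMap`; the same text is the `hP` of A-p08's `stub_S2pair_holds`, so v4.4 re-points `stub_S2pair := 
stub_S2pair_holds stub_borel stub_periodChart` the day that closer lands, adding the FACT stub `stub_borel : siegel_borel_extension`).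
Registered stubs after v4.3: {stub_S1, stub_frame, stub_S2inj, stub_S2pair, stub_periodChart, stub_Squot, stub_S4} (7; `stub_S2imm` closed).

EDITION v4.2 (B-plan2 g5, 2026-08-28): = v4.1 (8335372e7052b58d) with exactly three tokens changed — `stub_frame : QArch.FrameExists'` and the
head through `QArch.ambientReceptacle_of'` (both ★ `…HypDel.ExtAmbientReceptacleQArchC`, B-p19), because v4 `QArch.FrameExists` is FALSE as
stated (B-p03 2026-08-28T15:32:50Z: W1 the `N = 0` tail forces an open level `⊥`; W2 no hermitian hypothesis when `hpos` is vacuous —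
`FrameExists'` binds `τ T hT` first and asks `0 < N`; ruling T3-v5 15:36:06Z).  Stub names, owners and every other statement unchanged.

TARGET (verbatim, by name): `Summit.HodgeConjecture.HodgeConjecture.Theses.HCCMUnconditional.HDel`.
HEAD: `HDel_proof := ExtReceptacle.HDel_of_receptacle (ambientReceptacle_of' stub_S1 stub_frame stub_S2inj stub_S2pair stub_S2imm stub_Squot stub_S4)`
(`stub_S2imm` a theorem since v4.3, `stub_S2pair` since v4.4, `stub_frame`/`stub_S2inj`/`stub_S4`/`stub_Squot` since v4.5, `stub_periodChart` since v4.6 — ALL provable stubs closed).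

WHY THIS LINE.  v3b reduced `HDel` (= I-1′ `canonicalModel_exists_ext_printed`, the E-model of the compact unitary Shimura variety with its
CM reciprocity at every special point) to ONE stub `stub_ambientReceptacle : AmbientReceptacleExists` — «a closed immersion of
`Sh_K(G,X) × (T_M-class set)` into the base change of an `E`-scheme `A` through which reciprocity is read» — and PROVED the rest
(image stability S5, closure descent S3, the head) ; those proofs now live in the tree as ★ τ0-T3 `CorCM/HypDel/ExtAmbientReceptacle*.lean`
(B-p19, p639362 / p639837 / p640251 / F4).  v4 decomposes the one remaining stub along Deligne's construction [Del71, §5; Del79, 2.3.10]: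
the receptacle is a FINITE QUOTIENT of a principal-level SIEGEL modular variety, reached through the symplectic embedding
`(U(V) × T_M) ↪ GSp(W₀ ⊕ V_M, ψ_{ξ₀,ξ})` of the auxiliary datum (★ (g-a1)–(g-a4), ★ (g-b) `auxComplexStructure`), at a PRODUCT level
`ũ_β⁻¹ K_δ(N) = K_V × L_V` (Q6b) below `K × L₀`, followed by the quotient by the finite group `(K × L₀)/(K_V × L_V)` acting through integral
Hecke operators of the Siegel ℚ-model (★ (σ4)-D `SiegelS1`, named fact #1 of this line = [Del71] Thm 4.21 for `GSp`; named fact #2 = (σ5) `siegel_borel_extension`, Borel 1972 / [MilISV] 3.14 + 3.12, consumed inside `stub_S2pair` — director s67: «kind beats count», FLOOR-G = 7 generic alongside the floor of record).  The principal-level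
receptacle WITHOUT the quotient is FALSE (F3′: units `ζ₃` of `M`; RECEPTACLE-PLAN §7.1) — hence the two-storey cut.

THE SEVEN STUBS (closed Props, universal over the I-1′ binder block; statements characterise construction data ONLY through POINT
FORMULAS and `GaloisIntertwines`, never through chosen isomorphisms):
* `stub_S1 : SiegelS1` — ★ (σ4)-D named fact ([Del71] 4.21 ∘ 4.17 ∘ Déf 3.1/3.13; [MilISV] 14.12) — closes by `Literature` citation only.
* `stub_frame : FrameExists'` (owner B-p03; Q6a ★ p639010, Q6b (i)–(iii), (iv) ★ B-p09, ξ-choice ★ `HilbertModularCMPoints.exists_im_pos`,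
  `C0pm` membership from B-typ01's (g-b) §6 positivity) — auxiliary scalars, symplectic frame, level sandwich `ũ⁻¹K_δ(N) ≤ K×L₀ ≤ ũ⁻¹K_δ(1)`,
  normality, product sublevels.
* `stub_S2inj : S2Inj` (owner A-p05; stationarity ★ p636331 + class-number pigeonhole ★ p637670) — injectivity on points at product level, for
  `m₀ ∣ N`.
* `stub_S2pair : S2Pair` — THEOREM of the file since v4.4 (`:= stub_S2pair_holds stub_borel stub_periodChart`, A-p08 g6 over α ★ p645594 / β ★:
  the Siegel point map is well defined on `Sh_{K_V} × Cl(L_V)`, each slice has a holomorphic Siegel lift read off the period chart after a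
  rational translate of negative multiplier, and Borel's extension theorem makes it a morphism, summand by summand).
* `stub_borel : siegel_borel_extension` (NEW v4.4) — ★ (σ5) NAMED FACT #61 (Borel 1972 Thm 3.10; [MilISV] 3.14 + 3.12; [Del71] 1.14) — closes by
  `Literature` citation only.
* `stub_S2imm : S2Imm` — THEOREM of the file since v4.3 (`:= S2Imm_of_periodChart stub_periodChart`, ★ p645479 B-p05: point-injective +
  immersive analytification + proper ⇒ closed immersion, Step C ★ p635438 + ★ p638708/p639679).
* `stub_periodChart` (NEW v4.3; owner B-p05 TARGET 1; M–L) — for every real similitude `γ` throwing all `J_{β,Φ}(x)` into `S⁺`, a holomorphic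
  `P : 𝔹² → Sym²` with injective differential, values in `𝔥_g`-coordinates, and `γ·J_{β,Φ}(x)·γ⁻¹ = J(Z(P x))` ([MilISV] §6; Lange (7.3)).
* `stub_Squot : SQuot` (lead B-p01; B-p06/B-p02 leaves ★; Q4 ★/p-pending level quotient of `complexSystemExt`, Q1 ★ p639089 equivariant closed immersions
  descend to finite quotients, Q5 ★ p637465 quasi-projectivity) — the `E`-receptacle `A`, its closed immersion `ι` at level `K × L₀`, and the
  points map `Ψ` intertwining Galois actions.
* `stub_S4 : S4Push` (owner A-p04; (B) B-p16) — Siegel reciprocity (`IsCanonical`, [MilISV] (62)) pushed down along `Ψ` = `ReciprocityThrough`.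
CIRCULARITY RULE (REF1): no stub consumes `exists_recordSystem` / `canonicalModel_exists_printed` / any `(S : RecordSystem …)`.
HISTORY: v1 (5 stubs, F3′-false receptacle) → v2/v3/v3b 2a4912bcb51bc6f9 (one stub + S3/S5 proved) → v4/v4.1 8335372e (seven stubs by import of
τ0 QArchA/B) → v4.2 85a4f33a (frame v5, QArchC) → v4.3 2ee8186f (S2imm closed by name) → v4.4 93754298 (S2pair closed by name over the Borel fact) → v4.5 00a52a1e (frame, S2inj, S4, Squot closed by name) → v4.6 (this file, FINAL; periodChart closed by name, `HDel_of_two_facts'`).  HC_CM is proved only modulo the 7 printed citations until rung 0 closes.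
[cite: Deligne1971TravauxShimura, §5, Thm 4.21, 1.15, 5.4] [cite: Deligne1979ShimuraVarieties, Prop. 2.3.10] [cite: Milne2005ShimuraVarieties, §14 Prop 14.12, §12 (62)]
-/

set_option linter.unusedVariables false

noncomputable section

open Literature.AlgebraicGeometry.ModuliOfAbelianVarieties (SiegelS1)
open Summit.HodgeConjecture.CorCM.HypDel.ExtReceptacle (AmbientReceptacleExists HDel_of_receptacle)
open Summit.HodgeConjecture.CorCM.HypDel.ExtReceptacle (QArch.FrameExists' QArch.S2Inj QArch.S2Pair QArch.S2Imm QArch.SQuot QArch.S4Push QArch.ambientReceptacle_of')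
open Summit.HodgeConjecture.CorCM.HypDel.ExtReceptacle.QArch (IsAuxScalars)
open Summit.HodgeConjecture.HodgeConjecture.Theorems (S2Imm_of_periodChart stub_S2pair_holds)
open Literature.AlgebraicGeometry.ShimuraVarieties (siegel_borel_extension)
open Function NumberField Matrix
open scoped Matrix ComplexOrder
open Literature.AlgebraicGeometry Literature.AlgebraicGeometry.Motives
open Literature.NumberTheory.Automorphic Literature.NumberTheory.Automorphic.UnitaryGroup
open Literature.Geometry.ComplexHyperbolic Literature.Geometry.ComplexHyperbolic.BallModel
open Literature.AlgebraicGeometry.ShimuraVarieties Literature.AlgebraicGeometry.ShimuraVarieties.UnitaryCanonicalModel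
open Literature.AlgebraicGeometry.ShimuraVarieties.UnitaryCanonicalModel.Aux
open Literature.AlgebraicGeometry.ModuliOfAbelianVarieties
open Literature.AlgebraicGeometry.ModuliOfAbelianVarieties.SiegelModuli (C0 jOfSiegel)
open Literature.NumberTheory.ModularForms.SiegelUpperHalfSpace (siegelUpperHalfSpaceCoord coordCLE)
open Literature.LinearAlgebra.Matrix (symmetricSubmodule)

namespace Summit.HodgeConjecture.CorCM.Cruxes.HypDel.F1ExtHodgeType

/-! ## §8 (v4.7). ONE registered FACT stub {S1}; `stub_borel` is a theorem since v4.7 (#61 table); every provable stub (+ `stub_frame`, `stub_S2inj`, `stub_S2pair`, `stub_S2imm`, `stub_Squot`, `stub_S4` closed by name) over the τ0 Props `…HypDel.ExtReceptacle.QArch.*` + the head -/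

/-! ### §1′ (v4.9-shape) THE MUMFORD LINE, END STATE — ONE registered FACT stub over the receptacle ★ `Summits/HodgeConjecture/CorCM/HypDel/MumfordModuliReceptacle.lean`
(ns `Summit.HodgeConjecture.CorCM.HypDel.MumfordModuli`, B-plan1 g6 FINAL R4) and B-p09's hypothesis-free head ★ `Summit.HodgeConjecture.HodgeConjecture.Theorems.MumfordRouteXi.cmConjugationIsogenyAll_holds` (route ξ′ assembly): `stub_S1` (#60, [Del71] Thm 4.21) is a THEOREM by
`MumfordModuli.siegelS1_of_cmConjugationIsogenyAll`.  Registered stubs of stmt-HodgeConjecture-24835 from this edition on = {`stub_mumford`} = the ONE printed citation left under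
hDel ([Del71] 4.16–4.17 / [MFK94] Thm 7.9, 7.10).  HC_CM is proved only modulo the 7 printed citations until rung 0 closes. -/

/-! ### §1″ (v5.5-C shape) THE CORES EDITION — `stub_Flarge` ([MFK94] Thm. 7.9 «for `n` large») is a THEOREM of ★ F-12-of-cores
`exists_threshold_siegelFineModuliScheme_of_cores` over the registered CORE stubs {`stub_II`, `stub_F3`, `stub_PL`, `stub_F11`} = the printed GENERIC ∕ MODULI-STANDARD
statements the cell's F-programme reduces (F) to (director g12 s238; human item (4) decides which cores are opened for bytes).  Each core ★ BY NAME later closes its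
stub by a one-line edition (v5.6-C, …) exactly as v4.2 → v4.7 did.  HC_CM is proved only modulo the 7 printed citations until rung 0 closes. -/

open CategoryTheory CategoryTheory.Limits AlgebraicGeometry TopologicalSpace Literature.AlgebraicGeometry.AbelianSchemes Literature.AlgebraicGeometry.Motives Literature.AlgebraicGeometry.ModuliOfAbelianVarieties Literature.AlgebraicGeometry.AbelianSchemes.PolarizedAbelianSchemeWithLevel Literature.AlgebraicGeometry.AbelianSchemes.AbelianSchemeOver in
open MonObj in
open Literature.AlgebraicGeometry.Morphisms (IsProjective) in
/-- **stub (FACT) CORE II — SERVED LETTER hII″ FROM v5.7 = [MumfordFogartyKirwan1994] Ch. 6 §3 Prop. 6.16 + Thm. 6.14 (representability half) ∕ Ch. 7 §2 Prop. 7.3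
step (II), PROJECTIVE `p₁`, group law as output DATA: for every `g`, for a PROJECTIVE smooth geometrically connected `p₁ : Z₁ → H₁` over a ℚ-scheme
locally of finite type with a section `ε₁`, the locus where the fibres carry an abelian-scheme structure of relative dimension `g` with identity `ε₁`
is an OPEN subscheme `j₂ : H₂ ↪ H₁` over which `Z₁` IS a group scheme smooth of relative dimension `g`, universally — the cell's (β)+(γ) letter hII″
(B-p17 (g15) `hII-double-prime.letter` 3c9b9074) with `∀ (g : ℕ)` in front = the binder `hII''` of ★ F-12-of-cores ED. 3
`exists_threshold_siegelFineModuliScheme_of_cores''` VERBATIM = the statement of the F-4 line theorem `Cruxes/HDel/Lines/F4LinearRigidificationII.lean`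
`stub_IIrep'` character for character (PROVED there modulo its layer-2 letters, all closed in HOME).** [GENERIC-WITH-DATA].  ≤ PRINT VERBATIM: (β) print
states Prop. 6.16 ∕ Thm. 6.14 for PROJECTIVE abelian schemes — the v5.5∕v5.6 letter had `proper` (stronger than print, REF1 g13 m14, s279 (1b)) and is hereby
repaired; (γ) the `IsClosed (Set.range j₂)` conjunct of Thm. 6.14's third step (Koizumi) is DROPPED — no consumer in the tree used it (FILE 2 destructured it
away).  CLOSED BY NAME (v5.8 «Q-II») over ★ p796432 `Literature.AlgebraicGeometry.AbelianSchemes.AbelianSchemeOver.exists_groupLawLocus_of_projective`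
(`AbelianSchemes/LinearRigidificationStepTwo.lean`, F0P1a-p02 (g2) F23): CORE II is a THEOREM; no `sorry` in this declaration.
[cite: MumfordFogartyKirwan1994, Ch. 6 §3 Proposition 6.16 (p. 126), Theorem 6.14 (p. 124); Ch. 7 §2 Proposition 7.3, step (II) (p. 132); Ch. 6 §3 Proposition 6.15 (p. 124), §1 Corollary 6.6 (p. 117)] -/
theorem stub_II : ∀ (g : ℕ) ⦃H₁ Z₁ : Scheme.{0}⦄ (p₁ : Z₁ ⟶ H₁) [IsProper p₁] [Smooth p₁] [GeometricallyConnected p₁]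
    (_ : IsProjective p₁)
    (f₁ : H₁ ⟶ Spec (.of ℚ)) [LocallyOfFiniteType f₁] (ε₁ : H₁ ⟶ Z₁) (_ : ε₁ ≫ p₁ = 𝟙 H₁),
    ∃ (H₂ : Scheme.{0}) (j₂ : H₂ ⟶ H₁) (_ : IsOpenImmersion j₂)
    (G : GrpObj (Over.mk (pullback.snd p₁ j₂))),
      (@MonObj.one _ _ _ (Over.mk (pullback.snd p₁ j₂)) G.toMonObj).left ≫ pullback.fst p₁ j₂ = j₂ ≫ ε₁ ∧
      SmoothOfRelativeDimension g (pullback.snd p₁ j₂) ∧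
      ∀ ⦃T : Scheme.{0}⦄ (v : T ⟶ H₁),
        (∃! w : T ⟶ H₂, w ≫ j₂ = v) ↔
          ∃ G' : GrpObj (Over.mk (pullback.snd p₁ v)),
            (@MonObj.one _ _ _ (Over.mk (pullback.snd p₁ v)) G'.toMonObj).left ≫ pullback.fst p₁ v = v ≫ ε₁ ∧
            SmoothOfRelativeDimension g (pullback.snd p₁ v) :=
  -- v5.8 «Q-II»: CORE II by the bare name of ★ F23 (p796432); statement ws-identical (718 chars)
  Literature.AlgebraicGeometry.AbelianSchemes.AbelianSchemeOver.exists_groupLawLocus_of_projective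

open CategoryTheory CategoryTheory.Limits AlgebraicGeometry TopologicalSpace Literature.AlgebraicGeometry.AbelianSchemes Literature.AlgebraicGeometry.Motives Literature.AlgebraicGeometry.ModuliOfAbelianVarieties Literature.AlgebraicGeometry.AbelianSchemes.PolarizedAbelianSchemeWithLevel Literature.AlgebraicGeometry.AbelianSchemes.AbelianSchemeOver in
open Literature.AlgebraicGeometry.Morphisms (IsProjective projectiveSpaceInt) in
open Literature.AlgebraicGeometry.HodgeTheory (IsQuasiProjectiveOver) in
/-- **stub (FACT) CORE F3 = letter (L) «dual pairs Zariski-locally of projective abelian schemes» (frozen; = ★ capstone `hF3` = 2B `hdual`)** [GENERIC-LIBRARY;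
print-DERIVED (REF1 g13 m14 (3)): [MFK Cor. 6.8] gives `Pic^τ(X∕S) = X̂` for `X∕S` PROJECTIVE; the letter assumes projectivity only ZARISKI-LOCALLY on `S` and
concludes a GLOBAL `Nonempty A.DualPair` — the Zariski-local duals are glued by universality (★ `DualPair.universal`: two dual pairs are uniquely
isomorphic ⇒ cocycle ⇒ Zariski gluing of `hat` and `𝒫`), standard but not printed in 6.8].
CLOSED BY NAME (v5.9 «Q-F3») over ★ p797885 `Summit.HodgeConjecture.CorCM.Cruxes.HypDel.F3DualAbelianScheme.stub_F3_holds`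
(`Theorems/F3DualAbelianSchemeStubF3.lean`, F0P1c-p06 (g2) T4): CORE F3 is a THEOREM; no `sorry` in this declaration.
[cite: MumfordFogartyKirwan1994, Cor. 6.8 (p. 118)] [cite: Lan2013PELCompactifications, Thm. 1.3.2.3 (p. 70)] -/
theorem stub_F3 : ∀ ⦃S : Scheme.{0}⦄ [IsLocallyNoetherian S] (_fS : S ⟶ Spec (.of ℚ)) (A : AbelianSchemeOver S),
    (∀ s : S, ∃ (U : Scheme.{0}) (i : U ⟶ S) (_ : IsOpenImmersion i) (_ : s ∈ Set.range i.base)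
      (B : AbelianSchemeOver U) (G : B.X.left ⟶ A.X.left), B.IsBaseChangeVia A i G ∧ IsProjective B.X.hom) →
    Nonempty A.DualPair :=
  -- v5.9 «Q-F3»: CORE F3 by the bare name of ★ T4 (p797885); statement token-identical
  Summit.HodgeConjecture.CorCM.Cruxes.HypDel.F3DualAbelianScheme.stub_F3_holds

open CategoryTheory CategoryTheory.Limits AlgebraicGeometry TopologicalSpace Literature.AlgebraicGeometry.AbelianSchemes Literature.AlgebraicGeometry.Motives Literature.AlgebraicGeometry.ModuliOfAbelianVarieties Literature.AlgebraicGeometry.AbelianSchemes.PolarizedAbelianSchemeWithLevel Literature.AlgebraicGeometry.AbelianSchemes.AbelianSchemeOver in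
/-- **stub (FACT) CORE PL = the Plücker letter of the linearly rigidified covariant: every `𝓗 : SiegelFramedCovariant g N δ J` locally of finite
type over ℚ (`N ≥ 3`, `#J + 1 = 6^g·d`) satisfies ★ `SiegelFramedCovariant.PL` — `H` quasi-compact, IMMERSED `ι_H : H → 𝐏^r_ℚ` over its structure
map, the class of `ι_H^*𝒪(m)` an integer combination of the determinants `[det π_*(L^Δ(λ)^{⊗k})]` and of the section classes `[sec_a^*L^Δ(λ)]` —
the binder `hPL` of ★ F-12-of-cores ED. 2 VERBATIM (the print-located residue of (H-rep) after R2⁺; director g12 s276 (i); REF1 (g13) m09∕m11 + ref2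
l23∕l24 ≤-print reads of record: EXISTENCE of `ι_H` = Prop. 7.4, the IDENTITY = the intrinsic form of the `PGL(m+1)`-linearisation, print-derived
from §7.2 (*), Def. 7.5, Prop. 6.13 (ii)(iv)).** [MODULI-STANDARD (GIT)].
[cite: MumfordFogartyKirwan1994, Ch. 7 §2 Proposition 7.4 (p. 135), §7.2 (*) (p. 131), Definition 7.5 (p. 130), Proposition 7.3 (p. 132)]
[cite: MumfordFogartyKirwan1994, Ch. 6 §2 Proposition 6.13 (ii)(iv) (p. 123)] -/
theorem stub_PL : ∀ ⦃g N : ℕ⦄ ⦃δ : Fin g → ℕ⦄ ⦃J : Type⦄ [Finite J], 0 < g → IsPolarizationType δ → 3 ≤ N →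
    Nat.card J + 1 = 6 ^ g * polarizationDegree δ →
    ∀ 𝓗 : SiegelFramedCovariant g N δ J, LocallyOfFiniteType 𝓗.H.hom → 𝓗.PL :=
  -- v5.7 «CORE II PRINT-EXACT»: the PRIMED F-13 head (★ p796000, ED. 2) takes the hII″-shaped `stub_II`
  Summit.HodgeConjecture.CorCM.Cruxes.HypDel.F13PluckerProducer.stub_PL_of_cores_holds' stub_II stub_F3

open CategoryTheory CategoryTheory.Limits AlgebraicGeometry TopologicalSpace Literature.AlgebraicGeometry.AbelianSchemes Literature.AlgebraicGeometry.Motives Literature.AlgebraicGeometry.ModuliOfAbelianVarieties Literature.AlgebraicGeometry.AbelianSchemes.PolarizedAbelianSchemeWithLevel Literature.AlgebraicGeometry.AbelianSchemes.AbelianSchemeOver in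
open Literature.AlgebraicGeometry.Morphisms (IsProjective projectiveSpaceInt) in
open Literature.AlgebraicGeometry.HodgeTheory (IsQuasiProjectiveOver) in
/-- **stub (FACT) CORE F11 = smoothness over ℚ of an abstract fine moduli scheme locally of finite type (frozen letter, B-p13 form)** [MODULI-STANDARD].
CLOSED BY NAME (v5.10 «Q-F11») over ★ `Summit.HodgeConjecture.CorCM.Cruxes.HypDel.F11SmoothRoadA.stub_F11_holds`
(`Theorems/F11SmoothRoadAStubF11.lean`, B-p05 (g20)): CORE F11 is a THEOREM; no `sorry` in this declaration — and none left in this file.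
[cite: Lan2013PELCompactifications, Thm. 1.4.1.11 (p. 91), Prop. 2.2.4.4 (p. 144) and Thm. 2.2.4.14 (p. 150)] -/
theorem stub_F11 : ∀ (g N : ℕ) (δ : Fin g → ℕ), 0 < g → IsPolarizationType δ → 3 ≤ N →
    ∀ 𝓜 : SiegelFineModuliScheme g N δ, LocallyOfFiniteType 𝓜.M.hom → Smooth 𝓜.M.hom :=
  -- v5.10 «Q-F11»: CORE F11 by the bare name of ★ p806948 (B-p05 (g20)); statement token-identical
  Summit.HodgeConjecture.CorCM.Cruxes.HypDel.F11SmoothRoadA.stub_F11_holds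

/-- **stub (FACT) (F≫) = row I-10 AT LARGE LEVEL — a THEOREM from v5.5-C on** (★ F-12-of-cores ED. 2 `exists_threshold_siegelFineModuliScheme_of_cores'` p793324 (B-p11 (g19) (iii), filer B-p06 (g14)) over the registered core stubs `stub_II`, `stub_F3`, `stub_PL`, `stub_F11`; was the ONE registered `sorry` of v5.4): for SOME threshold `β (g, δ)`, fine moduli carriers
`𝓜 : SiegelFineModuliScheme g N δ` with the three clauses of (F) (smooth over `ℚ`, quasi-projective, quasi-projective universal total space) exist at
every level `N ≥ 3` with `β g δ ≤ N` — [MumfordFogartyKirwan1994] Thm. 7.9 «for `n` large» VERBATIM (= the F-12 assembly minus its ★ F-10 node: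
F-8 ∕ F-9 ∕ F-11 at large level); closes by citation, or by the cell's F-DAG roads ((L3) ∕ (γ)), count-neutral either way.  Why it might fail: not
mathematically (a theorem in print since 1965); AS TYPED, only by drift between the tree's carrier (`SiegelFineModuliScheme.classify` over
`PolarizedAbelianSchemeWithLevel`, Def. 6.3 polarisation with `exists_ample` at every geometric point — director s220 ∕ s224) and MFK's functor `𝓐_{g,d,n}`,
which the (L3) ∕ (γ) censuses price leaf by leaf.
[cite: MumfordFogartyKirwan1994, Thm. 7.9 (p. 139)] [cite: Lan2013PELCompactifications, Thm. 1.4.1.11 (p. 91) and Cor. 7.2.3.9 (p. 518)] -/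
theorem stub_Flarge :
    ∃ β : (g : ℕ) → (Fin g → ℕ) → ℕ, ∀ (g N : ℕ) (δ : Fin g → ℕ), 0 < g →
      Literature.AlgebraicGeometry.ModuliOfAbelianVarieties.IsPolarizationType δ → 3 ≤ N → β g δ ≤ N →
      ∃ 𝓜 : Literature.AlgebraicGeometry.ModuliOfAbelianVarieties.SiegelFineModuliScheme g N δ,
        AlgebraicGeometry.Smooth 𝓜.M.hom ∧ Literature.AlgebraicGeometry.HodgeTheory.IsQuasiProjectiveOver 𝓜.M ∧
          Literature.AlgebraicGeometry.HodgeTheory.IsQuasiProjectiveOver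
            (CategoryTheory.Over.mk (CategoryTheory.CategoryStruct.comp 𝓜.univ.A.X.hom 𝓜.M.hom) :
              Literature.AlgebraicGeometry.Motives.SchemeOver ℚ) :=
  -- v5.7 «CORE II PRINT-EXACT» (F-12-of-cores ED. 3, (β)+(γ) set row 4): the FOUR registered cores feed the ★ ed.-3 head in its binder order.
  Literature.AlgebraicGeometry.ModuliOfAbelianVarieties.exists_threshold_siegelFineModuliScheme_of_cores''
    stub_II stub_F3 stub_PL stub_F11

/-- **stub (F) = row I-10 — a THEOREM from v5.4 on** (★ p766238 F-10 LEVEL DESCENT `lan2013_siegelFineModuliScheme_of_large_levels` over `stub_Flarge`; was the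
registered `sorry` of v5.3) — ★ `lan2013_siegelFineModuliScheme` BY NAME: for `0 < g`, a polarisation type `δ` and `N ≥ 3` the Siegel moduli functor `𝓐_{g,δ,N}` is
represented by a fine moduli scheme, smooth and quasi-projective over `ℚ`: raise the level past `β g δ` and DESCEND ([MumfordFogartyKirwan1994] Ch. 7 §3, the remark after
Thm. 7.9 «true even if `n ≥ 3`», Lemma 7.11; [Lan2013PELCompactifications] Cor. 1.4.1.12).
[cite: Lan2013PELCompactifications, Thm. 1.4.1.11 (p. 91) and Cor. 7.2.3.9 (p. 518)] [cite: MumfordFogartyKirwan1994, Thm. 7.9 (p. 139)] -/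
theorem stub_F : Literature.AlgebraicGeometry.ModuliOfAbelianVarieties.lan2013_siegelFineModuliScheme := by
  -- (v5.4-shape) a THEOREM: ★ F-10 level descent over the large-level fact stub
  obtain ⟨β, h⟩ := stub_Flarge
  exact Literature.AlgebraicGeometry.ModuliOfAbelianVarieties.lan2013_siegelFineModuliScheme_of_large_levels β h

/-- **stub (F′) = row #65′ — a THEOREM from v5.3 on** (★ E-road head `relDim_of_F stub_F`; was the registered `sorry` of v5.2): for `0 < g`, a polarisation type `δ` and `N ≥ 3` the
Siegel moduli functor is represented by a fine moduli scheme, smooth OF RELATIVE DIMENSION `g(g+1)/2` and quasi-projective over `ℚ`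
(★ (F′) BY NAME; closes by citation only).
[cite: GortzWedhorn2023, Thm. 27.301 (p. 733)] [cite: Lan2013PELCompactifications, Thm. 1.4.1.11 (p. 91) and Cor. 7.2.3.9 (p. 518)] -/
theorem stub_F' : Literature.AlgebraicGeometry.ModuliOfAbelianVarieties.lan2013_siegelFineModuliScheme_relDim :=
  -- (v5.3-shape) a THEOREM: EQUIDIM BY PROOF — the E-road head over (F)
  Summit.HodgeConjecture.HodgeConjecture.Theorems.EquidimRelDimOfF.relDim_of_F stub_F

/-- **stub (FACT) (U) = row I-11** — ★ `siegelModuli_complexUniformisation` BY NAME: the complex uniformisation of the fine moduli schemes at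
the Siegel levels (`ℂ`-points = the adelic double cosets, classifying points of admissible marked triples read as `[J, a]`); closes by citation only.
[cite: MumfordFogartyKirwan1994, App. 7A (pp. 235–236)] [cite: Deligne1971TravauxShimura, 4.12–4.21 pp. 148–152] [cite: Milne2005ShimuraVarieties, §6 Thm. 6.11 p. 74] -/
theorem stub_U : Literature.AlgebraicGeometry.ModuliOfAbelianVarieties.siegelModuli_complexUniformisation :=
  -- (v5.2-shape) a THEOREM: ★ `UOfF.U_of_relDim_F` — the (U) road of UHead v0.22, kernel-checked end to end
  Summit.HodgeConjecture.HodgeConjecture.Theorems.UOfF.U_of_relDim_F stub_F'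

/-- **stub M1′ = #60′ — a THEOREM from v5.0 on** (★ E-FU head `M1prime_of_F_U stub_F stub_U`; v4.9: ★ `deligne1971_siegelModuliOnPoints` BY NAME, closed by citation; books: #60′ → CLOSED-BY-DERIVATION over (F)/(U)).
[cite: Deligne1971TravauxShimura, 4.16–4.17 p. 150 and proof of Thm. 4.21 p. 152] [cite: MumfordFogartyKirwan1994, Thm. 7.9 and 7.10] -/
theorem stub_mumford : Literature.AlgebraicGeometry.ModuliOfAbelianVarieties.deligne1971_siegelModuliOnPoints :=
  -- (v5.0-shape) a THEOREM: ★ E-FU head `M1prime_of_F_U` over the TWO registered fact stubs (F), (U) below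
  Summit.HodgeConjecture.CorCM.HypDel.M1primeOfFU.M1prime_of_F_U stub_F stub_U


/-- **stub S1 (NAMED FACT, closes by citation of ★ (σ4)-D only; XL behind it)** — the Siegel modular tower `Sh_{K_δ(N)}(GSp_δ, S^±)`,
`N ≥ 3`, has a canonical ℚ-model with integral Hecke operators: [Del71] Thm 4.21 (via [MFK94] 7.9/7.10) + Déf 3.1/3.13 at the CM pairs
of 4.18, reciprocity (62) of [MilISV].  Why plausible: it is a theorem in print since 1971.  Size: FACT (never proved here). -/
theorem stub_S1 : SiegelS1 :=
  -- (v4.9-shape) a THEOREM: ★ `MumfordModuli.siegelS1_of_cmConjugationIsogenyAll` over the ONE fact stub and B-p09's ★ route-ξ′ head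
  Summit.HodgeConjecture.CorCM.HypDel.MumfordModuli.siegelS1_of_cmConjugationIsogenyAll stub_mumford
    Summit.HodgeConjecture.HodgeConjecture.Theorems.MumfordRouteXi.cmConjugationIsogenyAll_holds

/-- **stub FRAME (owner B-p03; M–L)** — auxiliary scalars `ξ₀, ξ` with the sign package, a symplectic frame `β` of
`(W₀ ⊕ V_M, ψ_{ξ₀,ξ})` of some type `δ` (Q6a ★ p639010 compact subgroups stabilise a lattice; Frobenius/symplectic basis ★), membership of
`J_{β,Φ}(z)` in `S^±` ((g-b) §6 positivity), a level `N₁` with the sandwich `ũ⁻¹K_δ(N) ≤ K×L₀ ≤ ũ⁻¹K_δ(1)` for `N₁ ∣ N` (Q6b (ii)), normality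
(Q6b (iv) ★ B-p09 pulled back), and PRODUCT sublevels `ũ⁻¹K_δ(N) = K_V × L_V` (Q6b (iii): an `𝓞_M`-stable split lattice), for
`N₁ ∣ N`, `0 < N` (v5 text `QArch.FrameExists'`: binds the archimedean frame `τ T hT` first; v4 `FrameExists` was false, W1/W2).  Why plausible:
[Del71] 5.11–5.12; every clause is lattice arithmetic.  Why it might fail: the product form needs the split lattice to be chosen `𝓞_M`-stable
in BOTH factors — part of the statement, not automatic. -/
theorem stub_frame : QArch.FrameExists' :=
  -- CLOSED BY NAME since v4.5 (★ p649453 B-p03 g7); kept under its stub name so the head is unchanged.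
  Summit.HodgeConjecture.HodgeConjecture.Theorems.stub_frame

/-- **stub S2inj (owner A-p05; M)** — injectivity of the point map `([x,a],[t]) ↦ [J_x, ũ(a,t)]` at PRODUCT level for `m₀ ∣ N`:
stationarity of stabilisers in the unitary tower (★ p636331) + class-group pigeonhole (★ p637670) + ★ `SiegelShimuraSet.mk_eq_mk_iff`;
the source level is the FULL preimage `ũ⁻¹K_δ(N)` (a smaller one factors through a proper quotient — dead line).  Why it might fail: only
if `m₀` is not allowed to depend on `(K₀, F)` — it is (`∃ m₀` after them). [cite: Deligne1971TravauxShimura, Prop. 1.15, 5.4] -/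
theorem stub_S2inj : QArch.S2Inj :=
  -- CLOSED BY NAME since v4.5 (★ p649252 A-p05 g6); kept under its stub name so the head is unchanged.
  Summit.HodgeConjecture.HodgeConjecture.Theorems.stub_S2inj

/-- **stub PERIOD CHART (NEW in v4.3; owner B-p05 g6, TARGET 1 `UnitaryAuxiliaryPeriodMap`; M–L)** — the text is VERBATIM the hypothesis
`hP` of ★ `S2Imm_of_periodChart` (p645479) and of ★ `stub_S2pair_holds` (v4.4): for every hermitian datum in the archimedean frame `τ T hT`,
every ext-adapted CM type `Φ`, auxiliary scalars and symplectic frame `F` of type `δ`, and every real similitude `γ ∈ GSp_δ(ℝ)` that throws ALL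
the complex structures `J_{β,Φ}(x)` (`x ∈ 𝔹²`) into `S⁺ = C0 δ`, there is a map `P : (Fin 2 → ℂ) → (Sym2 (Fin g) → ℂ)`, holomorphic on the
ball with injective differential, valued in the `𝔥_g`-coordinates, with `γ·J_{β,Φ}(x)·γ⁻¹ = J(Z)` for `Z = (coordCLE g).symm (P x)`.
ROUTE (B-p05 15:42:46Z «left-eigenrow»): `Z = siegelOfJ δ (γJγ⁻¹)` is read off the `+i` left eigenrow space of `J_ℂ` (Lange (7.3),
★ `siegelPeriodMatrix_mul_jOfSiegel`, ★ `isUnit_det_toBlocks₁₂`), which for `J_{β,Φ}(x) = P_ℝ·res_b(B_x)·Q_ℝ` (★ (g-a2) `auxRep`) depends on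
`lift x` through FIXED matrices and one inverse — holomorphy is then algebraic; the immersion clause is the ball's Harish-Chandra embedding
being an immersion ([MilISV] §6 pp. 67–70, Thm. 5.16 / Def. 5.15; [Lange–Birkenhake] (7.3)).  Why it might fail: only through the ORIENTATION
of ★ `auxComplexStructure` (if it were the conjugate of Deligne's `h_W(i)`, `P` would be ANTI-holomorphic — (g-b) §6 shows `J ∈ X⁻`, whence the
`γ` of negative multiplier in the statement; a residual sign would be repaired inside `FrameExists'`, not by a new fact).
[cite: Milne2005ShimuraVarieties, §6 pp. 67–70, Thm 5.16, Def 5.15] [cite: Deligne1979ShimuraVarieties, Prop. 2.3.10] -/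
theorem stub_periodChart :
    ∀ (L : Type) [Field L] [NumberField L] [IsCMField L] (H : Matrix (Fin 3) (Fin 3) L) (τ : L →+* ℂ)
      (T : GL (Fin 3) ℂ), formCongr (starRingEnd ℂ) T (H.map τ) = BallModel.J →
      (∀ τ' : L →+* ℂ, InfinitePlace.mk τ' ≠ InfinitePlace.mk τ → (H.map τ').PosDef) →
      ∀ (M : Type) [Field M] [NumberField M] [IsCMField M] (j : L →+* M) (Φ : CMType M), IsExtAdapted τ j Φ →
      ∀ (ξ₀ ξ : M) (g : ℕ) (δ : Fin g → ℕ) (F : SymplecticFrame M j H ξ₀ ξ g δ),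
      IsAuxScalars M Φ ξ₀ ξ → 0 < g → IsPolarizationType δ →
      ∀ γ : ↥(gspReal δ), (∀ x : Ball, conjJ (γ : GL (Fin g ⊕ Fin g) ℝ) (auxComplexStructure F τ Φ T x) ∈ C0 δ) →
        ∃ P : (Fin 2 → ℂ) → (Sym2 (Fin g) → ℂ), DifferentiableOn ℂ P BallForms.ballSet ∧
          (∀ w ∈ BallForms.ballSet, Function.Injective (fderiv ℂ P w)) ∧
          ∀ x : Ball, P x.1 ∈ siegelUpperHalfSpaceCoord g ∧
            conjJ (γ : GL (Fin g ⊕ Fin g) ℝ) (auxComplexStructure F τ Φ T x) =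
              jOfSiegel δ (((coordCLE g).symm (P x.1) : symmetricSubmodule (Fin g) ℂ) : Matrix (Fin g) (Fin g) ℂ) :=
  -- CLOSED BY NAME since v4.6 (★ p650963 B-p05 g6 TARGET 1); kept under its stub name so the head is unchanged.
  Summit.HodgeConjecture.HodgeConjecture.Theorems.stub_periodChart_holds

/-- **stub BOREL (NEW in v4.4; NAMED FACT, closes by citation of ★ (σ5) `Literature/AlgebraicGeometry/ShimuraVarieties/SiegelBorelExtension.lean`
only; fan-B inventory row #61, GENERIC)** — Borel's extension theorem in the form the line consumes: every point map from a smooth projective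
complex record piece `Sc.Mc_K(ℂ)` of `Sh(U(H), 𝔹²)` (neat level) to a principal-level Siegel variety `Sg.Mc_{K_δ(N)}(ℂ)`, `N ≥ 3`, that has
HOLOMORPHIC SIEGEL LIFTS (`HasHolomorphicSiegelLift`: piecewise through the two ★ uniformisations, holomorphic on the negative cone of
`H^τ`) is `AlgPoints.map ι′` of a morphism of `ℂ`-schemes.  Why plausible: [Borel 1972] Thm 3.10 (`Γ` torsion-free) + Baily–Borel
([MilISV] Thm 3.12) = [MilISV] Thm 3.14 / [Del71] 1.14 — in print since 1972; no `F/Φ/J/ũ` occurs in the fact, so it is insensitive to the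
orientation of ★ `auxComplexStructure`.  Size: FACT (never proved here). [cite: Borel1972ExtensionTheorem, Thm. 3.10 p. 559]
[cite: Milne2005ShimuraVarieties, Thm. 3.14, Thm. 3.12] [cite: Deligne1971TravauxShimura, 1.14] -/
theorem stub_borel : siegel_borel_extension :=
  -- CLOSED BY NAME since v4.7 (★ p653988 A-p14 g6 `SiegelBorelExtensionHolds.lean`; L3 ★ p652662 B-p20 g4; L1 ★ p652289 B-p03 g8; N3 ★ p651661)
  Literature.AlgebraicGeometry.ShimuraVarieties.siegel_borel_extension_holds

/-- **S2pair — CLOSED BY NAME since v4.4** (`stub_S2pair_holds`, A-p08 g6: α ★ p645594 `exists_siegelPointMap` (B-p09) gives the class map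
`(p, [x, aK_V]) ↦ [J_x, ũ(a,t_p)·K_δ(N)]` at the product level; β ★ `hasHolomorphicSiegelLift_auxSlice` gives each summand's point map a
holomorphic Siegel lift — the piece `q` and the rational translate `γ` are constant along a slice (negative multiplier, `X = X⁺ ⊔ X⁻`,
★ `neg_auxComplexStructure_mem_C0`) and the lift is the period chart `stub_periodChart`; then `stub_borel`
(`siegel_borel_extension.exists_sigmaDesc`) summand by summand and the point formula `PointFormulaN`).  Kept under its stub name so the head
is unchanged. [cite: Milne2005ShimuraVarieties, Thm 3.14, Thm 5.16] [cite: Deligne1971TravauxShimura, 1.14, 1.15, 5.4] -/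
theorem stub_S2pair : QArch.S2Pair := stub_S2pair_holds stub_borel stub_periodChart

/-- **S2imm — CLOSED BY NAME since v4.3** (★ p645479 `S2Imm_of_periodChart`, B-p05 g6: a morphism of smooth quasi-projective complex
varieties which is injective on complex points (`ParamInjective` + `PointFormulaN`), whose analytification is an immersion (the period chart
`stub_periodChart` composed with the two ★ local biholomorphic uniformisations) and which is proper, is a closed immersion — ★ p635438
`isClosedImmersion_left_of_isProper_of_injective_of_injective_mfderiv`).  Kept under its stub name so the head is unchanged. -/
theorem stub_S2imm : QArch.S2Imm := S2Imm_of_periodChart stub_periodChart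

/-- **stub Squot (LEAD B-p01 g6 since 2026-08-28T16:06Z — D5 ★ p646411, D3; B-p06 g4 D2b ★ p644280 / D4-bkk ★ p643488 and B-p02 g3 Q4 ★ p640359/p643475 before; B-p18 g9 second; L)** — from the closed immersion `ι′` at product level and `R.HasIntegralHecke`: the finite group
`(K×L₀)/(K_V×L_V)` acts freely-enough on the source (Q4: `complexSystemExt_isLevelQuotient`, ★/pending) and through `K_δ(1)/K_δ(N)` on the
Siegel ℚ-model; the equivariant closed immersion descends to the finite quotients (Q1 ★ p639089, char 0), the quotient `A` of the Siegel
`E`-model is a quasi-projective `E`-scheme (Q5 ★ p637465), and the points map `Ψ` = (quotient map on ℂ-points) intertwines the Galois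
actions because the Hecke operators are `ℚ`-rational.  Why it might fail: the kernel of `(K×L₀)/(K_V×L_V) → K_δ(1)/K_δ(N)` must act
trivially on the source — it does, since `ι′` is a monomorphism (note in RECEPTACLE-PLAN §7.2 Step E). -/
theorem stub_Squot : QArch.SQuot :=
  -- CLOSED BY NAME since v4.5 (★ p650383 B-p01 g6); kept under its stub name so the head is unchanged.
  Summit.HodgeConjecture.CorCM.HypDel.ExtReceptacle.QArch.stub_Squot

/-- **stub S4 (owner A-p04 g7 — (A) special-pair CM structure, (C) push-down; (B) `ReflexNormSwap` B-p16 g5; A-p05 second; M–L)** — Siegel reciprocity pushed down: at a special point `([x,a],[t])` the Siegel point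
`[J_x, ũ(a,t)]` is CM for the CM algebra `M_x × M` with CM type from `Φ` and the line of `x` ((σ4)-D `CMStructure`/`IsSpecial`), so
`R.IsCanonical` ((62) of [MilISV]) gives `σ • P = r(s_σ) • P` on `R.ptQ`; `GaloisIntertwines` transports it along `Ψ` to `A`, and the
reflex-norm bookkeeping ★ `UnitaryAuxiliaryTorusReflexNorm` identifies `r(s_σ)` with `(recipFactor, reflexNormFiniteIdele)` = `ReciprocityThrough`.
Why it might fail: sign conventions (LEFT action, `art = rec⁻¹`, un-inverted `N_Φ`; ref2 13:52:12Z confirmed (i)(ii)) must match ★ `IsDiagTwist`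
— a mismatch shows up as an inverse, repairable inside the proof. [cite: Milne2005ShimuraVarieties, §12 (62), Prop 14.12] -/
theorem stub_S4 : QArch.S4Push :=
  -- CLOSED BY NAME since v4.5 (★ p650008 A-p04 g7); kept under its stub name so the head is unchanged.
  Summit.HodgeConjecture.HodgeConjecture.Theorems.stub_S4

/-- **`HDel` — the crux of stmt-HodgeConjecture-24835, BY NAME** (v4.2–v4.4 head: ★ F4 `HDel_of_receptacle` ∘ ★ QArchC `QArch.ambientReceptacle_of'`).
HC_CM is proved only modulo the 7 printed citations until rung 0 closes. -/
theorem HDel_proof : Summit.HodgeConjecture.HodgeConjecture.Theses.HCCMUnconditional.HDel :=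
  HDel_of_receptacle (QArch.ambientReceptacle_of' stub_S1 stub_frame stub_S2inj stub_S2pair stub_S2imm stub_Squot stub_S4)

/-- **GENERIC-FLOOR FORM (v4.6, FINAL)** — `HDel` from the TWO NAMED FACTS alone: every provable input of the Q-architecture receptacle is a ★
theorem of the tree (frame B-p03 · S2inj A-p05 · S2pair-analytic A-p08/B-p09 · period chart B-p05 · Squot B-p01 · S4 A-p04/B-p16), so this declaration
has NO `sorry` in its cone (`#print axioms` = {propext, Classical.choice, Quot.sound}).  Same term as A-p08's by-name file
`Theorems/HCCMUnconditionalHDelOfTwoFacts.lean :: HDel_of_two_facts` (director s83 (2)); primed here to avoid the name clash under `open`. -/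
theorem HDel_of_two_facts' (hS1 : SiegelS1) (hB : siegel_borel_extension) :
    Summit.HodgeConjecture.HodgeConjecture.Theses.HCCMUnconditional.HDel :=
  HDel_of_receptacle
    (QArch.ambientReceptacle_of' hS1 stub_frame stub_S2inj (stub_S2pair_holds hB stub_periodChart) stub_S2imm
      stub_Squot stub_S4)


/-- **(v4.7) `HDel` modulo the ONE remaining named fact #60 `SiegelS1`** ([Del71] Thm 4.21: the Siegel modular variety is the moduli
scheme `A_{g,δ,N}` over `ℚ`).  `stub_borel` is the theorem `siegel_borel_extension_holds` since v4.7, so the generic-floor form specialises;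
`#print axioms` (§9) shows no `sorryAx`. -/
theorem HDel_of_S1 (hS1 : SiegelS1) :
    Summit.HodgeConjecture.HodgeConjecture.Theses.HCCMUnconditional.HDel :=
  HDel_of_two_facts' hS1 stub_borel

end Summit.HodgeConjecture.CorCM.Cruxes.HypDel.F1ExtHodgeType

end

/-! ## §9 (v4.6/v4.7) AUDIT — the generic-floor form and (v4.7) `HDel_of_S1` have no `sorry` in their cones. -/
#print axioms Summit.HodgeConjecture.CorCM.Cruxes.HypDel.F1ExtHodgeType.HDel_of_two_facts'
#print axioms Summit.HodgeConjecture.CorCM.Cruxes.HypDel.F1ExtHodgeType.HDel_of_S1
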